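import Literature.AlgebraicGeometry.Resolution.HironakaDirectrix
import Mathlib.Algebra.MvPolynomial.PDeriv
import Mathlib.RingTheory.MvPolynomial.EulerIdentity
import HarnessLib

/-!
# Hironaka's `τ` of a quadratic form: the kernel of the polar map is translation invariant (char ≠ 2)

Topic: `Literature/AlgebraicGeometry/Resolution`.  `HironakaDirectrix` defines the invariance space
`𝕎(S) = {w | F(Y + wT) = F(Y) ∀ F ∈ S}` and `τ(S) = d − dim 𝕎(S)`.  For a single form `F` the
first-order Taylor coefficient shows `𝕎({F}) ⊆ ker (w ↦ D_w F)`, `D_w F = Σᵢ wᵢ ∂ᵢF` (the polar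
bound, companion file `HironakaDirectrixPolar`).  Here we prove the CONVERSE for QUADRATIC forms when
`2 ≠ 0` in `k` — the case `ν = 2`, which carries 224 of the 231 order-`a₁` points of the FE30 step
census (146 of them in characteristic `≠ 2`, all DROP, where this file applies; the 78 in
characteristic `2` include all 31 STALL points and lie outside the criterion):

* `translate_rename_eq_of_isHomogeneous_two` — the exact second-order expansion
  `F(Y + wT) = F(Y) + T · D_w F(Y) + F(w) · T²` for `F` homogeneous of degree `2` (any commutative
  ring; per monomial `c·YᵢYⱼ`, `translate_rename_C_mul_X_mul_X`);
* `eval_sum_C_mul_pderiv_of_isHomogeneous` — Euler at the point `w`: `(D_w F)(w) = n · F(w)`;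
* `mem_invarianceSpace_iff_of_isHomogeneous_two` — every characteristic: `w ∈ 𝕎({F}) ⟺ D_w F = 0 ∧
  F(w) = 0` (the `T`- and `T²`-coefficients), the description the census twin enumerates at `p = 2`;
* `mem_invarianceSpace_of_isHomogeneous_two` / `ker_polar_le_invarianceSpace_of_isHomogeneous_two` —
  `2 ≠ 0`, `F` quadratic, `D_w F = 0 ⟹ w ∈ 𝕎({F})`;
* `hironakaTau_le_finrank_span_pderiv_of_isHomogeneous_two` — hence **`τ({F}) ≤ dim ⟨∂ᵢF⟩`**, which
  with the polar bound `dim ⟨∂ᵢF⟩ ≤ τ({F})` gives `τ = rank of the gradient span` (= rank of the Gram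
  matrix) for every quadratic tangent cone in characteristic `≠ 2`;
* `hironakaTau_le_one_of_pderiv_mem_span_singleton` — all partials proportional to one polynomial
  ⟹ `τ ≤ 1` (the shape a STALL forces, cf. `WeightedCentreStepDirectrix`).

In characteristic `2` the statement is false as a criterion (`Y₀² + Y₁²` has all partials `0` but
`τ = 1` over a perfect field) — hence the hypothesis.  References: [CoP1] = Cossart–Piltant 2008,
proof of Prop. 4.2 (`τ`, `𝕎` intrinsic); [CJS] = Cossart–Jannsen–Saito 2020, Lemma 2.7 / Def. 2.8
(directrix, `e = n − dim`).  Instrument typing for the resolution observatory (pub-rosobs, carver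
g38); NOT summit progress.
-/

noncomputable section

open MvPolynomial

namespace Literature.AlgebraicGeometry.Resolution

universe u

/-! ## Exponents of degree two -/

section Degree

/-- An exponent vector of degree `2` is `eᵢ + eⱼ` (possibly `i = j`). [folklore] -/
private theorem exists_eq_single_add_single_of_degree_eq_two {σ : Type*} (s : σ →₀ ℕ)
    (h : s.degree = 2) : ∃ i j : σ, s = Finsupp.single i 1 + Finsupp.single j 1 := by
  classical
  have hs0 : s ≠ 0 := by
    rintro rfl
    simp at h
  obtain ⟨i, hi⟩ : ∃ i, s i ≠ 0 := by simpa using DFunLike.ne_iff.1 hs0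
  have h1 : Finsupp.single i 1 ≤ s := Finsupp.single_le_iff.2 (Nat.one_le_iff_ne_zero.2 hi)
  have hss' : s = Finsupp.single i 1 + (s - Finsupp.single i 1) :=
    (add_tsub_cancel_of_le h1).symm
  set s' := s - Finsupp.single i 1 with hs'def
  have hd' : s'.degree = 1 := by
    have := congrArg Finsupp.degree hss'
    rw [map_add, Finsupp.degree_single, h] at this
    omega
  have hs'0 : s' ≠ 0 := by
    intro h0
    rw [h0, map_zero] at hd'
    exact zero_ne_one hd'
  obtain ⟨j, hj⟩ : ∃ j, s' j ≠ 0 := by simpa using DFunLike.ne_iff.1 hs'0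
  have h2 : Finsupp.single j 1 ≤ s' := Finsupp.single_le_iff.2 (Nat.one_le_iff_ne_zero.2 hj)
  have hs's'' : s' = Finsupp.single j 1 + (s' - Finsupp.single j 1) :=
    (add_tsub_cancel_of_le h2).symm
  have hd'' : (s' - Finsupp.single j 1).degree = 0 := by
    have := congrArg Finsupp.degree hs's''
    rw [map_add, Finsupp.degree_single, hd'] at this
    omega
  have h0 : s' - Finsupp.single j 1 = 0 := (Finsupp.degree_eq_zero_iff _).1 hd''
  refine ⟨i, j, ?_⟩
  rw [hss', hs's'', h0, add_zero]

end Degree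

/-! ## The polar `D_w = Σ wₗ ∂ₗ` on products, and the second-order expansion -/

section Expansion

variable (k : Type u) [CommRing k] {d : ℕ}

/-- `D_w (C a) = 0`. [folklore] -/
private theorem polar_C (w : Fin d → k) (a : k) :
    ∑ l, C (w l) * pderiv l (C a : MvPolynomial (Fin d) k) = 0 := by
  simp

/-- `D_w Yᵢ = wᵢ`. [folklore] -/
private theorem polar_X (w : Fin d → k) (i : Fin d) :
    ∑ l, C (w l) * pderiv l (X i : MvPolynomial (Fin d) k) = C (w i) := by
  classical
  simp [pderiv_X, Pi.single_apply, mul_ite, Finset.sum_ite_eq]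

/-- Leibniz for `D_w`. [folklore] -/
private theorem polar_mul (w : Fin d → k) (G H : MvPolynomial (Fin d) k) :
    ∑ l, C (w l) * pderiv l (G * H) =
      (∑ l, C (w l) * pderiv l G) * H + G * ∑ l, C (w l) * pderiv l H := by
  simp only [pderiv_mul, mul_add, Finset.sum_add_distrib, Finset.sum_mul, Finset.mul_sum]
  congr 1 <;> exact Finset.sum_congr rfl fun l _ => by ring

/-- `D_w` is additive. [folklore] -/
private theorem polar_add (w : Fin d → k) (G H : MvPolynomial (Fin d) k) :
    ∑ l, C (w l) * pderiv l (G + H) =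
      (∑ l, C (w l) * pderiv l G) + ∑ l, C (w l) * pderiv l H := by
  simp only [map_add, mul_add, Finset.sum_add_distrib]

/-- **Second-order expansion of a quadratic monomial**:
`(c YᵢYⱼ)(Y + wT) = c YᵢYⱼ + T · D_w(c YᵢYⱼ) + c wᵢwⱼ · T²`.
[cite: CossartPiltant2008, proof of Prop. 4.2], [cite: CossartJannsenSaito2020, Lemma 2.7] -/
theorem translate_rename_C_mul_X_mul_X (w : Fin d → k) (c : k) (i j : Fin d) :
    translate k w (rename some (C c * X i * X j)) =
      rename some (C c * X i * X j)
        + X none * rename some (∑ l, C (w l) * pderiv l (C c * X i * X j))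
        + C (eval w (C c * X i * X j)) * X none ^ 2 := by
  have hpol : ∑ l, C (w l) * pderiv l (C c * X i * X j : MvPolynomial (Fin d) k) =
      C c * (C (w i) * X j + X i * C (w j)) := by
    rw [polar_mul, polar_mul, polar_C, polar_X, polar_X]
    ring
  have hev : eval w (C c * X i * X j : MvPolynomial (Fin d) k) = c * w i * w j := by simp
  rw [hpol, hev]
  simp only [map_mul, map_add, algHom_C, MvPolynomial.algebraMap_eq, rename_X, translate_X_some]
  ring

/-- **Second-order expansion of a quadratic form** (any commutative ring):
`F(Y + wT) = F(Y) + T · D_w F(Y) + F(w) · T²` for `F` homogeneous of degree `2`, where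
`D_w F = Σₗ wₗ ∂ₗF`. [cite: CossartPiltant2008, proof of Prop. 4.2], [cite: CossartJannsenSaito2020,
Lemma 2.7] -/
theorem translate_rename_eq_of_isHomogeneous_two (w : Fin d → k) {F : MvPolynomial (Fin d) k}
    (hF : F.IsHomogeneous 2) :
    translate k w (rename some F) =
      rename some F + X none * rename some (∑ l, C (w l) * pderiv l F)
        + C (eval w F) * X none ^ 2 := by
  classical
  -- every monomial of `F` is `c · YᵢYⱼ`
  have key : ∀ s ∈ F.support, ∃ i j : Fin d,
      monomial s (coeff s F) = C (coeff s F) * X i * X j := by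
    intro s hs
    have hdeg : s.degree = 2 := by
      rw [Finsupp.degree_eq_weight_one]
      exact hF (mem_support_iff.1 hs)
    obtain ⟨i, j, rfl⟩ := exists_eq_single_add_single_of_degree_eq_two s hdeg
    refine ⟨i, j, ?_⟩
    rw [monomial_single_add, pow_one, ← C_mul_X_eq_monomial]
    ring
  -- the right-hand side is additive in `F`
  let Φ : MvPolynomial (Fin d) k →+ MvPolynomial (Option (Fin d)) k :=
    AddMonoidHom.mk'
      (fun G => rename some G + X none * rename some (∑ l, C (w l) * pderiv l G)
        + C (eval w G) * X none ^ 2)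
      fun G H => by
        rw [polar_add]
        simp only [map_add]
        ring
  have hΦ : ∀ G, Φ G = rename some G + X none * rename some (∑ l, C (w l) * pderiv l G)
      + C (eval w G) * X none ^ 2 := fun G => rfl
  rw [← hΦ F]
  conv_lhs => rw [F.as_sum]
  conv_rhs => rw [F.as_sum]
  rw [map_sum, map_sum, map_sum]
  refine Finset.sum_congr rfl fun s hs => ?_
  obtain ⟨i, j, hij⟩ := key s hs
  rw [hij, hΦ]
  exact translate_rename_C_mul_X_mul_X k w _ i j

/-- **Euler's identity at a point**: for `F` homogeneous of degree `n`, `(D_w F)(w) = n · F(w)`.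
[cite: CossartJannsenSaito2020, Lemma 2.7] -/
theorem eval_sum_C_mul_pderiv_of_isHomogeneous (w : Fin d → k) {F : MvPolynomial (Fin d) k}
    {n : ℕ} (hF : F.IsHomogeneous n) :
    eval w (∑ l, C (w l) * pderiv l F) = n * eval w F := by
  have h := congrArg (eval w) hF.sum_X_mul_pderiv
  simp only [map_sum, map_mul, eval_X, nsmul_eq_mul, map_natCast] at h
  simp only [map_sum, map_mul, eval_C]
  exact h

end Expansion

/-! ## Over a field with `2 ≠ 0`: the kernel of the polar map is invariant -/

section Field

variable (k : Type u) [Field k] {d : ℕ}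

/-- **Membership criterion for a quadratic form, every characteristic**:
`w ∈ 𝕎({F}) ⟺ D_w F = 0 ∧ F(w) = 0` — compare the `T`- and `T²`-coefficients of the second-order
expansion.  In characteristic `2` the second condition is NOT implied by the first (e.g. `Y₀² + Y₁²`,
`w = e₀`), and `{w ∈ ker D | F(w) = 0}` is the subspace the census twin enumerates at the `p = 2`
points. [cite: CossartPiltant2008, proof of Prop. 4.2], [cite: CossartJannsenSaito2020, Lemma 2.7 and
Def. 2.8] -/
theorem mem_invarianceSpace_iff_of_isHomogeneous_two {F : MvPolynomial (Fin d) k}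
    (hF : F.IsHomogeneous 2) {w : Fin d → k} :
    w ∈ invarianceSpace k ({F} : Set (MvPolynomial (Fin d) k)) ↔
      (∑ l, C (w l) * pderiv l F = 0 ∧ eval w F = 0) := by
  classical
  constructor
  · intro hw
    have h := (mem_invarianceSpace_iff k).1 hw F rfl
    rw [translate_rename_eq_of_isHomogeneous_two k w hF, add_assoc, add_eq_left] at h
    -- `h : T · D + F(w) · T² = 0`; cancel one `T`
    have h' : (X none : MvPolynomial (Option (Fin d)) k) *
        (rename some (∑ l, C (w l) * pderiv l F) + C (eval w F) * X none) = 0 := by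
      rw [← h]
      ring
    have h2 := (mul_eq_zero.1 h').resolve_left (X_ne_zero _)
    -- the `Y`-part has no `T`: differentiate in `T`
    have hpd : pderiv none
        (rename some (∑ l, C (w l) * pderiv l F) : MvPolynomial (Option (Fin d)) k) = 0 := by
      apply pderiv_eq_zero_of_notMem_vars
      intro hmem
      obtain ⟨i, -, hi⟩ := Finset.mem_image.1 (vars_rename _ _ hmem)
      exact Option.some_ne_none i hi
    have hc : eval w F = 0 := by
      have := congrArg (pderiv none) h2
      rw [map_add, hpd, zero_add, pderiv_C_mul, pderiv_X_self, mul_one, map_zero, C_eq_zero] at this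
      exact this
    refine ⟨?_, hc⟩
    rw [hc, map_zero, zero_mul, add_zero, ← map_zero (rename some)] at h2
    exact rename_injective some (Option.some_injective _) h2
  · rintro ⟨hD, hev⟩
    rw [mem_invarianceSpace_iff]
    intro G hG
    rw [Set.mem_singleton_iff] at hG
    subst hG
    rw [translate_rename_eq_of_isHomogeneous_two k w hF, hD, hev, map_zero, map_zero, mul_zero,
      add_zero, zero_mul, add_zero]

/-- **`2 ≠ 0`, `F` quadratic, `D_w F = 0 ⟹ w ∈ 𝕎({F})`**: by Euler `2 F(w) = (D_w F)(w) = 0`, so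
the expansion collapses to `F(Y + wT) = F(Y)`. [cite: CossartPiltant2008, proof of Prop. 4.2],
[cite: CossartJannsenSaito2020, Lemma 2.7 and Def. 2.8] -/
theorem mem_invarianceSpace_of_isHomogeneous_two (h2 : (2 : k) ≠ 0) {F : MvPolynomial (Fin d) k}
    (hF : F.IsHomogeneous 2) {w : Fin d → k} (hw : ∑ l, C (w l) * pderiv l F = 0) :
    w ∈ invarianceSpace k ({F} : Set (MvPolynomial (Fin d) k)) := by
  rw [mem_invarianceSpace_iff]
  intro G hG
  rw [Set.mem_singleton_iff] at hG
  subst hG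
  have hev : eval w G = 0 := by
    have h := eval_sum_C_mul_pderiv_of_isHomogeneous k w hF
    rw [hw, map_zero, Nat.cast_ofNat] at h
    exact (mul_eq_zero.1 h.symm).resolve_left h2
  rw [translate_rename_eq_of_isHomogeneous_two k w hF, hw, hev, map_zero, map_zero, mul_zero,
    add_zero, zero_mul, add_zero]

/-- **`ker (w ↦ Σ wᵢ ∂ᵢF) ⊆ 𝕎({F})`** for a quadratic form `F` when `2 ≠ 0` (the converse inclusion
holds for every form: `HironakaDirectrixPolar`). [cite: CossartPiltant2008, proof of Prop. 4.2],
[cite: CossartJannsenSaito2020, Lemma 2.7 and Def. 2.8] -/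
theorem ker_polar_le_invarianceSpace_of_isHomogeneous_two (h2 : (2 : k) ≠ 0)
    {F : MvPolynomial (Fin d) k} (hF : F.IsHomogeneous 2) :
    LinearMap.ker (Fintype.linearCombination k fun i : Fin d => pderiv i F) ≤
      invarianceSpace k ({F} : Set (MvPolynomial (Fin d) k)) := by
  intro w hw
  rw [LinearMap.mem_ker, Fintype.linearCombination_apply] at hw
  refine mem_invarianceSpace_of_isHomogeneous_two k h2 hF ?_
  simpa [MvPolynomial.smul_eq_C_mul] using hw

/-- **`τ({F}) ≤ dim ⟨∂₁F, …, ∂_d F⟩`** for a quadratic form `F` when `2 ≠ 0`: with the polar bound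
this pins `τ` of every quadratic tangent cone in characteristic `≠ 2` to the rank of its gradient
span. [cite: CossartPiltant2008, proof of Prop. 4.2 (τ(x) := dim T_x)],
[cite: CossartJannsenSaito2020, Def. 2.8 (e = n − dim 𝒯)] -/
theorem hironakaTau_le_finrank_span_pderiv_of_isHomogeneous_two (h2 : (2 : k) ≠ 0)
    {F : MvPolynomial (Fin d) k} (hF : F.IsHomogeneous 2) :
    hironakaTau k ({F} : Set (MvPolynomial (Fin d) k)) ≤
      Module.finrank k (Submodule.span k (Set.range fun i : Fin d => pderiv i F)) := by
  set f := Fintype.linearCombination k fun i : Fin d => pderiv i F with hf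
  have hrange : LinearMap.range f = Submodule.span k (Set.range fun i : Fin d => pderiv i F) :=
    Fintype.range_linearCombination k _
  have hrn := LinearMap.finrank_range_add_finrank_ker f
  rw [Module.finrank_fin_fun] at hrn
  have hker : Module.finrank k (LinearMap.ker f) ≤
      Module.finrank k (invarianceSpace k ({F} : Set (MvPolynomial (Fin d) k))) :=
    Submodule.finrank_mono (ker_polar_le_invarianceSpace_of_isHomogeneous_two k h2 hF)
  have hτ := hironakaTau_add_finrank_invarianceSpace k ({F} : Set (MvPolynomial (Fin d) k))
  rw [← hrange]
  omega

/-- **All partials proportional ⟹ `τ ≤ 1`** (quadratic `F`, `2 ≠ 0`): if every `∂ᵢF` is a multiple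
of one polynomial `P` then `τ({F}) ≤ 1` — the shape of the tangent cone at a STALL point.
[cite: CossartPiltant2008, proof of Prop. 4.2], [cite: CossartJannsenSaito2020, Def. 2.8] -/
theorem hironakaTau_le_one_of_pderiv_mem_span_singleton (h2 : (2 : k) ≠ 0)
    {F : MvPolynomial (Fin d) k} (hF : F.IsHomogeneous 2) (P : MvPolynomial (Fin d) k)
    (hP : ∀ i : Fin d, pderiv i F ∈ k ∙ P) :
    hironakaTau k ({F} : Set (MvPolynomial (Fin d) k)) ≤ 1 := by
  refine le_trans (hironakaTau_le_finrank_span_pderiv_of_isHomogeneous_two k h2 hF) ?_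
  have hle : Submodule.span k (Set.range fun i : Fin d => pderiv i F) ≤ k ∙ P :=
    Submodule.span_le.2 (by rintro _ ⟨i, rfl⟩; exact hP i)
  refine le_trans (Submodule.finrank_mono hle) ?_
  simpa using finrank_span_le_card ({P} : Set (MvPolynomial (Fin d) k))

/-- Worked instance (`2 ≠ 0`): `τ(Y₀²) ≤ 1` in `k[Y₀, Y₁, Y₂]` by the gradient (all partials are
multiples of `Y₀`). [cite: CossartJannsenSaito2020, Def. 2.8] -/
theorem hironakaTau_sq_le_one (h2 : (2 : k) ≠ 0) :
    hironakaTau k ({X 0 ^ 2} : Set (MvPolynomial (Fin 3) k)) ≤ 1 := by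
  refine hironakaTau_le_one_of_pderiv_mem_span_singleton k h2 ((isHomogeneous_X k 0).pow 2)
    (X 0) fun i => ?_
  rw [Submodule.mem_span_singleton]
  refine ⟨if i = 0 then 2 else 0, ?_⟩
  split_ifs with hi
  · subst hi
    rw [pderiv_pow, pderiv_X_self, mul_one, pow_one, Nat.cast_ofNat, MvPolynomial.smul_eq_C_mul,
      map_ofNat]
  · rw [zero_smul, pderiv_pow, pderiv_X_of_ne (Ne.symm hi), mul_zero]

end Field

end Literature.AlgebraicGeometry.Resolution

end
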